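import Mathlib
import Summits.Ventures.PercRepro2.Defs
import Summits.Ventures.PercRepro2.Harris
import Summits.Ventures.PercRepro2.Graph
import Summits.Ventures.PercRepro2.Events
import Summits.Ventures.PercRepro2.ZCSeriesPointwise
import Summits.Ventures.PercRepro2.ZCSeries

/-!
# Series reduction of the three-event form (T_h) (blind cell PercRepro2, mine-a g46;
MINE-A.md §101.7)

A vertex `v` that is neither the root `s` nor the hit vertex `h` nor seen by the up-sets (`𝓤`, `𝓥`
blind to `v`: `S ∈ 𝓤 ↔ S \ {v} ∈ 𝓤`), joined to the rest only by `f₁ = xv` and `f₂ = vy` (every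
other edge at `v` lies in the zero-weight set `D`), is invisible to the cluster events of `s` once
the two edges in series are replaced by ONE edge `xy` of weight `p f₁ · p f₂` — in the fixed-`(V, E)`
vocabulary of `ZCSeries`: re-route `f₁` to `s(x, y)` with weight `p f₁ · p f₂` and give `f₂` weight
`0`.  Each of the seven probabilities of the (T)-form is the same in the two graphs
(`ZCSeries.prob_series` on the four pointwise correspondences `series_conn_11 … series_conn_00` of
`ZCSeriesPointwise`, read through `clusterInEvent_iff_of_blind`), hence

  **`T(p, ends, s, h) = T(p', ends', s, h)`**   (`t_expr_series`)

and (T_h) on the series-reduced graph gives (T_h) on `G` (`t_of_series`).  With the cut-vertex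
transfers of `TCutVertex` / `TCutVertexNear` / `TCutVertexHit`, the lane's open instances of (T_h)
may be taken with minimum degree `≥ 3` off `{s, h} ∪ generators` and 2-connected between them.
No definition; one seat.
-/

namespace Summit.Ventures.PercRepro2

namespace TSeries

variable {V : Type*} {E : Type*} [Fintype E] [DecidableEq E] {R : Type*} [CommRing R]
  {ends : E → Sym2 V} {x v y : V} {f₁ f₂ : E}

/-- **Series reduction of the (T)-form.** -/
theorem t_expr_series (p : E → R) (hf₁ : ends f₁ = s(x, v)) (hf₂ : ends f₂ = s(v, y)) (hxv : x ≠ v)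
    (hyv : y ≠ v) (hf : f₁ ≠ f₂) (D : Finset E) (hD₁ : f₁ ∉ D) (hD₂ : f₂ ∉ D)
    (hDp : ∀ e ∈ D, p e = 0) (hD : ∀ e, v ∈ ends e → e = f₁ ∨ e = f₂ ∨ e ∈ D)
    (s h : V) (hs : s ≠ v) (hh : h ≠ v) {𝓤 𝓥 : Set (Set V)}
    (hU : ∀ S, S ∈ 𝓤 ↔ S \ {v} ∈ 𝓤) (hV : ∀ S, S ∈ 𝓥 ↔ S \ {v} ∈ 𝓥) :
    prob p (clusterInEvent ends s {T : Set V | h ∈ T} ∩ clusterInEvent ends s 𝓤 ∩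
        clusterInEvent ends s 𝓥) +
      prob p (clusterInEvent ends s {T : Set V | h ∈ T}) *
        prob p (clusterInEvent ends s 𝓤 ∩ clusterInEvent ends s 𝓥) -
      prob p (clusterInEvent ends s {T : Set V | h ∈ T} ∩ clusterInEvent ends s 𝓤) *
        prob p (clusterInEvent ends s 𝓥) -
      prob p (clusterInEvent ends s {T : Set V | h ∈ T} ∩ clusterInEvent ends s 𝓥) *
        prob p (clusterInEvent ends s 𝓤) =
    prob (Function.update (Function.update p f₁ (p f₁ * p f₂)) f₂ 0)
        (clusterInEvent (Function.update ends f₁ s(x, y)) s {T : Set V | h ∈ T} ∩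
          clusterInEvent (Function.update ends f₁ s(x, y)) s 𝓤 ∩
          clusterInEvent (Function.update ends f₁ s(x, y)) s 𝓥) +
      prob (Function.update (Function.update p f₁ (p f₁ * p f₂)) f₂ 0)
          (clusterInEvent (Function.update ends f₁ s(x, y)) s {T : Set V | h ∈ T}) *
        prob (Function.update (Function.update p f₁ (p f₁ * p f₂)) f₂ 0)
          (clusterInEvent (Function.update ends f₁ s(x, y)) s 𝓤 ∩
            clusterInEvent (Function.update ends f₁ s(x, y)) s 𝓥) -
      prob (Function.update (Function.update p f₁ (p f₁ * p f₂)) f₂ 0)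
          (clusterInEvent (Function.update ends f₁ s(x, y)) s {T : Set V | h ∈ T} ∩
            clusterInEvent (Function.update ends f₁ s(x, y)) s 𝓤) *
        prob (Function.update (Function.update p f₁ (p f₁ * p f₂)) f₂ 0)
          (clusterInEvent (Function.update ends f₁ s(x, y)) s 𝓥) -
      prob (Function.update (Function.update p f₁ (p f₁ * p f₂)) f₂ 0)
          (clusterInEvent (Function.update ends f₁ s(x, y)) s {T : Set V | h ∈ T} ∩
            clusterInEvent (Function.update ends f₁ s(x, y)) s 𝓥) *
        prob (Function.update (Function.update p f₁ (p f₁ * p f₂)) f₂ 0)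
          (clusterInEvent (Function.update ends f₁ s(x, y)) s 𝓤) := by
  have hω : ∀ ω₀ : Config E, (∀ e ∈ D, ω₀ e = false) →
      ∀ e, v ∈ ends e → e = f₁ ∨ e = f₂ ∨ ω₀ e = false := by
    intro ω₀ hD0 e he
    rcases hD e he with h | h | h
    · exact Or.inl h
    · exact Or.inr (Or.inl h)
    · exact Or.inr (Or.inr (hD0 e h))
  have key : ∀ (Z Z' : Set (Config E)),
      (∀ ω₀ : Config E, ω₀ f₁ = false → ω₀ f₂ = false → (∀ e ∈ D, ω₀ e = false) →
        (Function.update (Function.update ω₀ f₁ true) f₂ true ∈ Z ↔ Function.update ω₀ f₁ true ∈ Z') ∧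
        (Function.update ω₀ f₁ true ∈ Z ↔ ω₀ ∈ Z') ∧ (Function.update ω₀ f₂ true ∈ Z ↔ ω₀ ∈ Z') ∧
        (ω₀ ∈ Z ↔ ω₀ ∈ Z')) →
      prob p Z = prob (Function.update (Function.update p f₁ (p f₁ * p f₂)) f₂ 0) Z' :=
    fun Z Z' h => prob_series p hf D hD₁ hD₂ hDp (fun ω₀ a b c => (h ω₀ a b c).1)
      (fun ω₀ a b c => (h ω₀ a b c).2.1) (fun ω₀ a b c => (h ω₀ a b c).2.2.1)
      (fun ω₀ a b c => (h ω₀ a b c).2.2.2)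
  -- the cluster events of the root for a `v`-blind up-set
  have cl : ∀ (𝓔 : Set (Set V)), (∀ S, S ∈ 𝓔 ↔ S \ {v} ∈ 𝓔) →
      ∀ ω₀ : Config E, ω₀ f₁ = false → ω₀ f₂ = false → (∀ e ∈ D, ω₀ e = false) →
      (Function.update (Function.update ω₀ f₁ true) f₂ true ∈ clusterInEvent ends s 𝓔 ↔
        Function.update ω₀ f₁ true ∈ clusterInEvent (Function.update ends f₁ s(x, y)) s 𝓔) ∧
      (Function.update ω₀ f₁ true ∈ clusterInEvent ends s 𝓔 ↔
        ω₀ ∈ clusterInEvent (Function.update ends f₁ s(x, y)) s 𝓔) ∧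
      (Function.update ω₀ f₂ true ∈ clusterInEvent ends s 𝓔 ↔
        ω₀ ∈ clusterInEvent (Function.update ends f₁ s(x, y)) s 𝓔) ∧
      (ω₀ ∈ clusterInEvent ends s 𝓔 ↔ ω₀ ∈ clusterInEvent (Function.update ends f₁ s(x, y)) s 𝓔) := by
    intro 𝓔 hblind ω₀ h₀₁ h₀₂ hD0
    exact ⟨clusterInEvent_iff_of_blind (fun u hu =>
        series_conn_11 hf₁ hf₂ hxv hyv hf h₀₁ h₀₂ (hω ω₀ hD0) hs hu) hblind,
      clusterInEvent_iff_of_blind (fun u hu => series_conn_10 hf₁ hxv h₀₁ h₀₂ (hω ω₀ hD0) hs hu) hblind,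
      clusterInEvent_iff_of_blind (fun u hu => series_conn_01 hf₂ hyv h₀₁ h₀₂ (hω ω₀ hD0) hs hu) hblind,
      clusterInEvent_iff_of_blind (fun u hu => series_conn_00 h₀₁ s u) hblind⟩
  have cQ := cl {T : Set V | h ∈ T} (blind_principal hh)
  have cU := cl 𝓤 hU
  have cE := cl 𝓥 hV
  have k1 := key (clusterInEvent ends s {T : Set V | h ∈ T} ∩ clusterInEvent ends s 𝓤 ∩
      clusterInEvent ends s 𝓥)
    (clusterInEvent (Function.update ends f₁ s(x, y)) s {T : Set V | h ∈ T} ∩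
      clusterInEvent (Function.update ends f₁ s(x, y)) s 𝓤 ∩
      clusterInEvent (Function.update ends f₁ s(x, y)) s 𝓥) (fun ω₀ a b c => by
    obtain ⟨q1, q2, q3, q4⟩ := cQ ω₀ a b c
    obtain ⟨u1, u2, u3, u4⟩ := cU ω₀ a b c
    obtain ⟨e1, e2, e3, e4⟩ := cE ω₀ a b c
    simp only [Set.mem_inter_iff, q1, q2, q3, q4, u1, u2, u3, u4, e1, e2, e3, e4, and_self])
  have k2 := key (clusterInEvent ends s {T : Set V | h ∈ T})
    (clusterInEvent (Function.update ends f₁ s(x, y)) s {T : Set V | h ∈ T}) cQ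
  have k3 := key (clusterInEvent ends s 𝓤 ∩ clusterInEvent ends s 𝓥)
    (clusterInEvent (Function.update ends f₁ s(x, y)) s 𝓤 ∩
      clusterInEvent (Function.update ends f₁ s(x, y)) s 𝓥) (fun ω₀ a b c => by
    obtain ⟨u1, u2, u3, u4⟩ := cU ω₀ a b c
    obtain ⟨e1, e2, e3, e4⟩ := cE ω₀ a b c
    simp only [Set.mem_inter_iff, u1, u2, u3, u4, e1, e2, e3, e4, and_self])
  have k4 := key (clusterInEvent ends s {T : Set V | h ∈ T} ∩ clusterInEvent ends s 𝓤)
    (clusterInEvent (Function.update ends f₁ s(x, y)) s {T : Set V | h ∈ T} ∩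
      clusterInEvent (Function.update ends f₁ s(x, y)) s 𝓤) (fun ω₀ a b c => by
    obtain ⟨q1, q2, q3, q4⟩ := cQ ω₀ a b c
    obtain ⟨u1, u2, u3, u4⟩ := cU ω₀ a b c
    simp only [Set.mem_inter_iff, q1, q2, q3, q4, u1, u2, u3, u4, and_self])
  have k5 := key (clusterInEvent ends s 𝓥) (clusterInEvent (Function.update ends f₁ s(x, y)) s 𝓥) cE
  have k6 := key (clusterInEvent ends s {T : Set V | h ∈ T} ∩ clusterInEvent ends s 𝓥)
    (clusterInEvent (Function.update ends f₁ s(x, y)) s {T : Set V | h ∈ T} ∩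
      clusterInEvent (Function.update ends f₁ s(x, y)) s 𝓥) (fun ω₀ a b c => by
    obtain ⟨q1, q2, q3, q4⟩ := cQ ω₀ a b c
    obtain ⟨e1, e2, e3, e4⟩ := cE ω₀ a b c
    simp only [Set.mem_inter_iff, q1, q2, q3, q4, e1, e2, e3, e4, and_self])
  have k7 := key (clusterInEvent ends s 𝓤) (clusterInEvent (Function.update ends f₁ s(x, y)) s 𝓤) cU
  rw [k1, k2, k3, k4, k5, k6, k7]

/-- **(T_h) transfers along the series reduction**: if the (T)-inequality holds on the
series-reduced graph, it holds on `G`. -/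
theorem t_of_series {R : Type*} [CommRing R] [LinearOrder R] [IsStrictOrderedRing R]
    (p : E → R) (hf₁ : ends f₁ = s(x, v))
    (hf₂ : ends f₂ = s(v, y)) (hxv : x ≠ v) (hyv : y ≠ v) (hf : f₁ ≠ f₂) (D : Finset E)
    (hD₁ : f₁ ∉ D) (hD₂ : f₂ ∉ D) (hDp : ∀ e ∈ D, p e = 0)
    (hD : ∀ e, v ∈ ends e → e = f₁ ∨ e = f₂ ∨ e ∈ D) (s h : V) (hs : s ≠ v) (hh : h ≠ v)
    {𝓤 𝓥 : Set (Set V)} (hU : ∀ S, S ∈ 𝓤 ↔ S \ {v} ∈ 𝓤) (hV : ∀ S, S ∈ 𝓥 ↔ S \ {v} ∈ 𝓥)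
    (hT : prob (Function.update (Function.update p f₁ (p f₁ * p f₂)) f₂ 0)
            (clusterInEvent (Function.update ends f₁ s(x, y)) s {T : Set V | h ∈ T} ∩
              clusterInEvent (Function.update ends f₁ s(x, y)) s 𝓤) *
          prob (Function.update (Function.update p f₁ (p f₁ * p f₂)) f₂ 0)
            (clusterInEvent (Function.update ends f₁ s(x, y)) s 𝓥) +
        prob (Function.update (Function.update p f₁ (p f₁ * p f₂)) f₂ 0)
            (clusterInEvent (Function.update ends f₁ s(x, y)) s 𝓤) *
          prob (Function.update (Function.update p f₁ (p f₁ * p f₂)) f₂ 0)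
            (clusterInEvent (Function.update ends f₁ s(x, y)) s {T : Set V | h ∈ T} ∩
              clusterInEvent (Function.update ends f₁ s(x, y)) s 𝓥) ≤
        prob (Function.update (Function.update p f₁ (p f₁ * p f₂)) f₂ 0)
            (clusterInEvent (Function.update ends f₁ s(x, y)) s {T : Set V | h ∈ T} ∩
              clusterInEvent (Function.update ends f₁ s(x, y)) s 𝓤 ∩
              clusterInEvent (Function.update ends f₁ s(x, y)) s 𝓥) +
          prob (Function.update (Function.update p f₁ (p f₁ * p f₂)) f₂ 0)
              (clusterInEvent (Function.update ends f₁ s(x, y)) s {T : Set V | h ∈ T}) *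
            prob (Function.update (Function.update p f₁ (p f₁ * p f₂)) f₂ 0)
              (clusterInEvent (Function.update ends f₁ s(x, y)) s 𝓤 ∩
                clusterInEvent (Function.update ends f₁ s(x, y)) s 𝓥)) :
    prob p (clusterInEvent ends s {T : Set V | h ∈ T} ∩ clusterInEvent ends s 𝓤) *
        prob p (clusterInEvent ends s 𝓥) +
      prob p (clusterInEvent ends s 𝓤) *
        prob p (clusterInEvent ends s {T : Set V | h ∈ T} ∩ clusterInEvent ends s 𝓥) ≤
      prob p (clusterInEvent ends s {T : Set V | h ∈ T} ∩ clusterInEvent ends s 𝓤 ∩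
          clusterInEvent ends s 𝓥) +
        prob p (clusterInEvent ends s {T : Set V | h ∈ T}) *
          prob p (clusterInEvent ends s 𝓤 ∩ clusterInEvent ends s 𝓥) := by
  have hid := t_expr_series p hf₁ hf₂ hxv hyv hf D hD₁ hD₂ hDp hD s h hs hh hU hV
  linarith [hid, hT]

end TSeries

end Summit.Ventures.PercRepro2
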